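import Mathlib
import Literature.Combinatorics.Additive.TripleProductProperty
import Summits.MatrixMultiplication.MatrixMultiplication.Theorems.SnSubsetDichotomyThresholdSubsetTriplesChainDefs

/-!
# `SnSubsetDichotomy.ThresholdSubsetTriples`, line `interleaved-subsignature-ascent` — stub `stub_push`

One-level TOKEN ELIMINATION for the chain classes of crux `stmt-MatrixMultiplication-10882`
(registered stub `stub_push` of the lead's skeleton
`Cruxes/ThresholdSubsetTriples/Lines/interleaved_subsignature_ascent.lean`).

For a token `t`, direction sets `E₁ E₂ E₃` and lower sets `L₁ L₂ L₃` of permutations fixing `t`,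
the triple `(starPiece E₁ t * L₁, starPiece E₂ t * L₂, starPiece E₃ t * L₃)` has the triple product
property (`Literature.Combinatorics.Additive.TripleProductProperty`, Cohn–Umans 2003, Def. 2.1) if and
only if `LevelCondition t E₁ E₂ E₃ L₁ L₂ L₃` holds (vocabulary file
`Theorems/SnSubsetDichotomyThresholdSubsetTriplesChainDefs.lean`).

Proof (folklore token push).  Write `s = swap(e₁,t)·a`, `s' = swap(e₁',t)·a'`, … for elements of the
three products.  Since `swap(e,t)⁻¹ = swap(e,t)` and `q · swap(e,t) = swap(q e, t) · q` whenever
`q t = t` (`mul_swap_of_apply_eq`), the TPP word `s s'⁻¹ (u u'⁻¹) (v v'⁻¹)` EQUALS, as a group element,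
the pushed word of `LevelCondition` (`tpp_word_eq_push_word`): the three lower quotients
`q₁ = a a'⁻¹`, `q₂ = b b'⁻¹`, `q₃ = c c'⁻¹` are moved to the right through the five star letters
following them.  Finally `swap(e,t)·a = swap(e',t)·a'` with `a t = a' t = t` splits as `e = e'`
(evaluate at `t`) and `a = a'` (cancel), `swap_mul_eq_swap_mul_iff`.  Both directions are then
bookkeeping with `Finset.mem_mul` / `mem_starPiece`.
-/

-- `Summit.<Summit>.<Problem>` is the tree's mandated summit-side namespace; for this
-- single-conjunct summit the two coincide, so the file silences `dupNamespace`.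
set_option linter.dupNamespace false
set_option autoImplicit false

namespace Summit.MatrixMultiplication.MatrixMultiplication.Theorems.ThresholdSubsetTriples

open scoped Pointwise
open Literature.Combinatorics.Additive

namespace StubPush

/-- One push step inside a left-associated word: `X · q · swap(e,t) = X · swap(q e, t) · q` when
`q t = t`. -/
theorem mul_mul_swap_of_apply_eq {α : Type*} [DecidableEq α] (X q : Equiv.Perm α) {t : α}
    (hq : q t = t) (e : α) :
    X * q * Equiv.swap e t = X * Equiv.swap (q e) t * q := by
  rw [mul_assoc, mul_swap_of_apply_eq q hq e, ← mul_assoc]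

/-- A product of two permutations fixing `t` fixes `t`. -/
theorem mul_apply_eq_self {α : Type*} {p q : Equiv.Perm α} {t : α} (hp : p t = t)
    (hq : q t = t) : (p * q) t = t := by
  rw [Equiv.Perm.mul_apply, hq, hp]

/-- A right quotient `a a'⁻¹` of two permutations fixing `t` fixes `t`. -/
theorem mul_inv_apply_eq_self {α : Type*} {a a' : Equiv.Perm α} {t : α} (ha : a t = t)
    (ha' : a' t = t) : (a * a'⁻¹) t = t :=
  mul_apply_eq_self ha (Equiv.Perm.inv_eq_iff_eq.mpr ha'.symm)

/-- **The token push** for three quotients `q₁ q₂ q₃` fixing `t`: the interleaved word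
`swap(e₁,t) q₁ swap(e₁',t) swap(e₂,t) q₂ swap(e₂',t) swap(e₃,t) q₃ swap(e₃',t)` equals the six-letter
star word `swap(e₁,t) swap(q₁e₁',t) swap(q₁e₂,t) swap(q₁q₂e₂',t) swap(q₁q₂e₃,t) swap(q₁q₂q₃e₃',t)`
times `q₁q₂q₃` (five applications of `mul_swap_of_apply_eq`). [folklore] -/
theorem push_word {α : Type*} [DecidableEq α] (t e₁ e₁' e₂ e₂' e₃ e₃' : α)
    (q₁ q₂ q₃ : Equiv.Perm α) (hq₁ : q₁ t = t) (hq₂ : q₂ t = t) (hq₃ : q₃ t = t) :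
    Equiv.swap e₁ t * q₁ * Equiv.swap e₁' t * Equiv.swap e₂ t * q₂ * Equiv.swap e₂' t
        * Equiv.swap e₃ t * q₃ * Equiv.swap e₃' t =
      Equiv.swap e₁ t * Equiv.swap (q₁ e₁') t * Equiv.swap (q₁ e₂) t
        * Equiv.swap ((q₁ * q₂) e₂') t * Equiv.swap ((q₁ * q₂) e₃) t
        * Equiv.swap ((q₁ * q₂ * q₃) e₃') t * (q₁ * q₂ * q₃) := by
  have hq₁₂ : (q₁ * q₂) t = t := mul_apply_eq_self hq₁ hq₂
  have hq₁₂₃ : (q₁ * q₂ * q₃) t = t := mul_apply_eq_self hq₁₂ hq₃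
  rw [mul_mul_swap_of_apply_eq _ q₁ hq₁, mul_mul_swap_of_apply_eq _ q₁ hq₁, mul_assoc _ q₁ q₂,
    mul_mul_swap_of_apply_eq _ (q₁ * q₂) hq₁₂, mul_mul_swap_of_apply_eq _ (q₁ * q₂) hq₁₂,
    mul_assoc _ (q₁ * q₂) q₃, mul_mul_swap_of_apply_eq _ (q₁ * q₂ * q₃) hq₁₂₃]

/-- **The TPP word is the pushed word.**  For `s = swap(e₁,t)·a`, `s' = swap(e₁',t)·a'`,
`u = swap(e₂,t)·b`, `u' = swap(e₂',t)·b'`, `v = swap(e₃,t)·c`, `v' = swap(e₃',t)·c'` with all of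
`a a' b b' c c'` fixing `t`, the TPP word `s s'⁻¹ (u u'⁻¹) (v v'⁻¹)` is, as a permutation, the word
of `LevelCondition` (`swap(e,t)⁻¹ = swap(e,t)`, reassociation, `push_word`). [folklore] -/
theorem tpp_word_eq_push_word {α : Type*} [DecidableEq α] (t e₁ e₁' e₂ e₂' e₃ e₃' : α)
    (a a' b b' c c' : Equiv.Perm α) (ha : a t = t) (ha' : a' t = t) (hb : b t = t)
    (hb' : b' t = t) (hc : c t = t) (hc' : c' t = t) :
    Equiv.swap e₁ t * a * (Equiv.swap e₁' t * a')⁻¹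
        * (Equiv.swap e₂ t * b * (Equiv.swap e₂' t * b')⁻¹)
        * (Equiv.swap e₃ t * c * (Equiv.swap e₃' t * c')⁻¹) =
      Equiv.swap e₁ t * Equiv.swap ((a * a'⁻¹) e₁') t * Equiv.swap ((a * a'⁻¹) e₂) t
        * Equiv.swap ((a * a'⁻¹ * (b * b'⁻¹)) e₂') t
        * Equiv.swap ((a * a'⁻¹ * (b * b'⁻¹)) e₃) t
        * Equiv.swap ((a * a'⁻¹ * (b * b'⁻¹) * (c * c'⁻¹)) e₃') t
        * (a * a'⁻¹ * (b * b'⁻¹) * (c * c'⁻¹)) := by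
  refine Eq.trans ?_ (push_word t e₁ e₁' e₂ e₂' e₃ e₃' (a * a'⁻¹) (b * b'⁻¹) (c * c'⁻¹)
    (mul_inv_apply_eq_self ha ha') (mul_inv_apply_eq_self hb hb') (mul_inv_apply_eq_self hc hc'))
  simp only [mul_inv_rev, Equiv.swap_inv, mul_assoc]

/-- Splitting an equality of top-extended words: for `a, a'` fixing `t`,
`swap(e,t)·a = swap(e',t)·a'` iff `e = e'` and `a = a'` (evaluate at `t`, then cancel). -/
theorem swap_mul_eq_swap_mul_iff {α : Type*} [DecidableEq α] {t e e' : α}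
    {a a' : Equiv.Perm α} (ha : a t = t) (ha' : a' t = t) :
    Equiv.swap e t * a = Equiv.swap e' t * a' ↔ e = e' ∧ a = a' := by
  constructor
  · intro h
    have he : e = e' := by
      have h' := congrArg (fun σ : Equiv.Perm α => σ t) h
      simpa only [Equiv.Perm.mul_apply, ha, ha', Equiv.swap_apply_right] using h'
    subst he
    exact ⟨rfl, mul_left_cancel h⟩
  · rintro ⟨rfl, rfl⟩
    rfl

/-- Elements `swap(e,t)·x` with `e ∈ E`, `x ∈ L` lie in the top-extended class `starPiece E t * L`. -/
theorem swap_mul_mem {α : Type*} [DecidableEq α] [Fintype α] {E : Finset α} {t e : α}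
    {L : Finset (Equiv.Perm α)} {x : Equiv.Perm α} (he : e ∈ E) (hx : x ∈ L) :
    Equiv.swap e t * x ∈ starPiece E t * L :=
  Finset.mul_mem_mul (mem_starPiece.2 ⟨e, he, rfl⟩) hx

end StubPush

open StubPush in
/-- **Stub `stub_push` — one-level token elimination** (line `interleaved-subsignature-ascent` of
crux `stmt-MatrixMultiplication-10882`).  For a token `t`, direction sets `E₁ E₂ E₃` and lower sets
`L₁ L₂ L₃ ⊆ Stab(t)`, the triple of top-extended classes
`(starPiece E₁ t * L₁, starPiece E₂ t * L₂, starPiece E₃ t * L₃)` has the triple product property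
(Cohn–Umans 2003, Def. 2.1) iff the token-eliminated `LevelCondition t E₁ E₂ E₃ L₁ L₂ L₃` holds:
the TPP word of `s = swap(e₁,t)a, …` IS the pushed word (`tpp_word_eq_push_word`), and
`swap(e,t)a = swap(e',t)a' ↔ e = e' ∧ a = a'` (`swap_mul_eq_swap_mul_iff`). [folklore] -/
theorem stub_push {α : Type*} [DecidableEq α] [Fintype α] (t : α) (E₁ E₂ E₃ : Finset α)
    (L₁ L₂ L₃ : Finset (Equiv.Perm α))
    (h₁ : ∀ τ ∈ L₁, τ t = t) (h₂ : ∀ τ ∈ L₂, τ t = t) (h₃ : ∀ τ ∈ L₃, τ t = t) :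
    TripleProductProperty (starPiece E₁ t * L₁) (starPiece E₂ t * L₂) (starPiece E₃ t * L₃) ↔
      LevelCondition t E₁ E₂ E₃ L₁ L₂ L₃ := by
  constructor
  · -- TPP → LevelCondition: un-push the relation to the TPP relation of `swap(eᵢ,t)·xᵢ`, then split.
    intro hT e₁ he₁ e₁' he₁' e₂ he₂ e₂' he₂' e₃ he₃ e₃' he₃' a ha a' ha' b hb b' hb' c hc c' hc'
      hrel
    rw [← tpp_word_eq_push_word t e₁ e₁' e₂ e₂' e₃ e₃' a a' b b' c c' (h₁ a ha) (h₁ a' ha')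
      (h₂ b hb) (h₂ b' hb') (h₃ c hc) (h₃ c' hc')] at hrel
    obtain ⟨k₁, k₂, k₃⟩ := hT _ (swap_mul_mem he₁ ha) _ (swap_mul_mem he₁' ha')
      _ (swap_mul_mem he₂ hb) _ (swap_mul_mem he₂' hb') _ (swap_mul_mem he₃ hc)
      _ (swap_mul_mem he₃' hc') hrel
    exact ⟨(swap_mul_eq_swap_mul_iff (h₁ a ha) (h₁ a' ha')).1 k₁,
      (swap_mul_eq_swap_mul_iff (h₂ b hb) (h₂ b' hb')).1 k₂,
      (swap_mul_eq_swap_mul_iff (h₃ c hc) (h₃ c' hc')).1 k₃⟩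
  · -- LevelCondition → TPP: unpack the six memberships, push the relation, apply the condition.
    intro hL s hs s' hs' u hu u' hu' v hv v' hv' hrel
    obtain ⟨y₁, hy₁, a, ha, rfl⟩ := Finset.mem_mul.1 hs
    obtain ⟨e₁, he₁, rfl⟩ := mem_starPiece.1 hy₁
    obtain ⟨y₁', hy₁', a', ha', rfl⟩ := Finset.mem_mul.1 hs'
    obtain ⟨e₁', he₁', rfl⟩ := mem_starPiece.1 hy₁'
    obtain ⟨y₂, hy₂, b, hb, rfl⟩ := Finset.mem_mul.1 hu
    obtain ⟨e₂, he₂, rfl⟩ := mem_starPiece.1 hy₂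
    obtain ⟨y₂', hy₂', b', hb', rfl⟩ := Finset.mem_mul.1 hu'
    obtain ⟨e₂', he₂', rfl⟩ := mem_starPiece.1 hy₂'
    obtain ⟨y₃, hy₃, c, hc, rfl⟩ := Finset.mem_mul.1 hv
    obtain ⟨e₃, he₃, rfl⟩ := mem_starPiece.1 hy₃
    obtain ⟨y₃', hy₃', c', hc', rfl⟩ := Finset.mem_mul.1 hv'
    obtain ⟨e₃', he₃', rfl⟩ := mem_starPiece.1 hy₃'
    rw [tpp_word_eq_push_word t e₁ e₁' e₂ e₂' e₃ e₃' a a' b b' c c' (h₁ a ha) (h₁ a' ha')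
      (h₂ b hb) (h₂ b' hb') (h₃ c hc) (h₃ c' hc')] at hrel
    obtain ⟨⟨rfl, rfl⟩, ⟨rfl, rfl⟩, ⟨rfl, rfl⟩⟩ := hL e₁ he₁ e₁' he₁' e₂ he₂ e₂' he₂' e₃ he₃
      e₃' he₃' a ha a' ha' b hb b' hb' c hc c' hc' hrel
    exact ⟨rfl, rfl, rfl⟩

end Summit.MatrixMultiplication.MatrixMultiplication.Theorems.ThresholdSubsetTriples
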